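import Summits.BirchSwinnertonDyer.Rank1Residual.P2.PrintCf2VLineRestriction
import Summits.BirchSwinnertonDyer.BirchSwinnertonDyer.Theorems.PrintCf2RubinValueTwoVLineSupply
import HarnessLib

/-!
# M-LINE-PIN stub (A) `stub_vLineRestriction` (crux `PrintCf2RubinValueTwo.MainConjClauseAtSplitTwoQuad`, stmt-BirchSwinnertonDyer-24086;
# skeleton `Cruxes/MainConjClauseAtSplitTwoQuad/Lines/m_line_pin.lean` l.192–232) — THE STATEMENT VERBATIM, AS A THEOREM

Cell `bsd-print-cf2`, discharge-interface typer `bsd-print-cf2-ty2` g36 (literature-prover seat; Summits-side helpers in the typer's directory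
`Rank1Residual/P2/`, Theses-free, no item). THEOREMS ONLY (no `def`, no named fact, no `sorry`). HONEST FRAMING: this file proves the REGISTERED
STUB (A) of the line `m_line_pin` with its binders byte-for-byte; it does not close the crux 24086 (stubs (Q), (R), (M), (T) remain) and the
skeleton's `sorry` is replaced only when LEAD cf2-p1 re-cuts the skeleton (`stub_vLineRestriction := VLineRestriction.stub_vLineRestriction`);
BSD is not proved by any of this; no summit statement is proved by this seat.

Composition: `VLineRestriction.vLineRestriction_of_supply` (the three clauses from the `v`-line supply, companion file) ∘ cf2c-w3 g6's
`VLineSupply.exists_vLineSupply_of_discr` (the `v`-line interpolation supply for every quadratic `θ_K` on a `discr K = −7` frame) with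
`G₁ ≠ 0` from the stub's own Müller clause (`VLineRestriction.ne_zero_of_charIdeal_map_eq_span`). Unused stub binders (odd class number, the
`δ`-clause, `κ₂` unramified outside `v̄`, `γ₁ ∈ I_v`, `γ₂ ∈ I_v̄`, `θ` non-trivial on `ker κ₁`) are carried verbatim and not used.

References: [deShalit1987] II Thm. 4.12, II.4.16 (49)–(50), II.4.17; [Muller2020SplitPrimeTwo] Thm. 2.4, Def. 2.5.
-/

noncomputable section

set_option autoImplicit false

open scoped Classical NumberField
open NumberField IsDedekindDomain Field
open Literature Literature.NumberTheory.GaloisRepresentations Literature.NumberTheory.EllipticCurves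
open Literature.NumberTheory.EllipticCurves.KellerYin2024 Literature.NumberTheory.EllipticCurves.GreenbergVatsal2000
open Literature.NumberTheory.EllipticCurves.DeShalit1987 Literature.NumberTheory.EllipticCurves.Muller2020
open Summit.BirchSwinnertonDyer.BirchSwinnertonDyer.Theorems Summit.BirchSwinnertonDyer.BirchSwinnertonDyer.Theorems.PrintCf2

namespace Summit.BirchSwinnertonDyer.Rank1Residual.P2.VLineRestriction

/-- **STUB (A) `stub_vLineRestriction` OF `m_line_pin`, VERBATIM** (skeleton l.192–232): on a DA7 frame, for `θ` quadratic with Hecke avatar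
`θ_K`, a two-variable Katz measure `G₂` of the `θ_K⁻¹`-branch and any `ν`-branch `G₁` of modulus `S'` generating the characteristic ideals
of the line's dual data: `π_v G₂ ≠ 0`; `(π_v G₂) = ((1+T) − u)·(G₁)` if `θ_K` is unramified at `v̄`; `(π_v G₂) = (G₁)` if `θ_K` is ramified at
`v̄`. [cite: deShalit1987, II Thm. 4.12 (i)–(ii) (31)–(32), II.4.16 (49)–(50), II.4.17 (52)–(54)] [cite: Muller2020SplitPrimeTwo, Thm. 2.4, Def. 2.5] -/
theorem stub_vLineRestriction :
    ∀ (K : Type) [Field K] [NumberField K], IsImaginaryQuadratic K → ¬ 2 ∣ NumberField.classNumber K →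
      NumberField.discr K = -7 →
    ∀ (ι : PadicAlgCl 2 ≃+* ℂ) (v vbar : HeightOneSpectrum (𝓞 K)),
      ((2 : ℕ) : 𝓞 K) ∈ v.asIdeal → ((2 : ℕ) : 𝓞 K) ∈ vbar.asIdeal → vbar ≠ v →
      (∀ (w : InfinitePlace K) (k : 𝓞 K), k ∈ v.asIdeal ↔ ‖ι.symm (w.embedding (k : K))‖ < 1) →
    ∀ (Ω δ : ℂ) (Ωp : (unrIntegers 2)ˣ), Ω ≠ 0 →
      (δ ^ 2 = (NumberField.discr K : ℂ) ∨ δ ^ 2 = -(NumberField.discr K : ℂ)) →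
    ∀ (κ₁ κ₂ : ZpExtension K 2) (γ₁ γ₂ : absoluteGaloisGroup K),
      ZpExtension.IsTopGeneratorPair κ₁ κ₂ γ₁ γ₂ → κ₂.IsUnramifiedOutside vbar →
      κ₁.IsUnramifiedOutside v → γ₁ ∈ GreenbergSelmer.inertia v → γ₂ ∈ GreenbergSelmer.inertia vbar →
    ∀ (θ : FramedGaloisRep K (padicCoeffIntegers (∅ : Set (PadicAlgCl 2))) 1),
      (∀ σ : absoluteGaloisGroup K, θ σ ^ 2 = 1) → (∃ σ ∈ κ₁.kerSubgroup, θ σ ≠ 1) →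
    ∀ (θK : HeckeCharacter K), KellerYin2024.IsHeckeCharOf ι θ θK →
    ∀ (S : Finset (HeightOneSpectrum (𝓞 K))), v ∉ S → vbar ∉ S →
      (∀ w ∈ S, ¬ θK.IsUnramifiedAt w) →
      (∀ w : HeightOneSpectrum (𝓞 K), w ∉ S → w ≠ v → w ≠ vbar → θK.IsUnramifiedAt w) →
    ∀ G₂ : PowerSeries (PowerSeries (PadicComplexInt 2)),
      IsKatzMeasure₂ ι v vbar S κ₁ κ₂ γ₁⁻¹ γ₂⁻¹ θK⁻¹ Ω δ ((Ωp : unrIntegers 2) : ℂ_[2]) G₂ →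
    -- Müller's branch on the `v`-line: modulus `S'` = exact ramification set of `θ_K` away from `v`, ANY admissible periods
    ∀ (S' : Finset (HeightOneSpectrum (𝓞 K))), v ∉ S' → (∀ w ∈ S', ¬ θK.IsUnramifiedAt w) →
      (∀ w : HeightOneSpectrum (𝓞 K), w ∉ S' → w ≠ v → θK.IsUnramifiedAt w) →
    ∀ (Ω' : ℂ) (Ωp' : (unrIntegers 2)ˣ) (G₁ : PowerSeries (PadicComplexInt 2)), Ω' ≠ 0 →
      IsNuBranch ι v S' κ₁ γ₁⁻¹ θK⁻¹ Ω' ((Ωp' : unrIntegers 2) : ℂ_[2]) G₁ →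
      (∀ D₁ : DatumDualData κ₁ γ₁ (KellerYin2024.charModule (∅ : Set (PadicAlgCl 2)) θ)
          (Castella2018.AcSelmer.bdpData (KellerYin2024.charModule (∅ : Set (PadicAlgCl 2)) θ) 2 vbar) ∅,
        Module.Finite (IwasawaAlgebra 2) D₁.X ∧ Module.IsTorsion (IwasawaAlgebra 2) D₁.X ∧
        ∀ (J : ℤ_[2] →+* PadicComplexInt 2),
          (∀ x : ℤ_[2], ((J x : PadicComplexInt 2) : ℂ_[2]) = ((x : ℚ_[2]) : ℂ_[2])) →
          (Module.charIdeal (IwasawaAlgebra 2) D₁.X).map (PowerSeries.map J) = Ideal.span {G₁}) →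
    PowerSeries.map (PowerSeries.constantCoeff (R := PadicComplexInt 2)) G₂ ≠ 0 ∧
    (θK.IsUnramifiedAt vbar →
      ∀ τ ∈ GreenbergSelmer.decomp vbar, κ₁ τ = κ₁ γ₁ → ∀ u : ℤ,
        (∀ m : KellerYin2024.charModule (∅ : Set (PadicAlgCl 2)) θ, τ • m = u • m) →
        Ideal.span ({PowerSeries.map (PowerSeries.constantCoeff (R := PadicComplexInt 2)) G₂} : Set (PowerSeries (PadicComplexInt 2))) =
          Ideal.span {((1 : PowerSeries (PadicComplexInt 2)) + PowerSeries.X) - (u : PowerSeries (PadicComplexInt 2))} *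
            Ideal.span {G₁}) ∧
    (¬ θK.IsUnramifiedAt vbar →
      Ideal.span ({PowerSeries.map (PowerSeries.constantCoeff (R := PadicComplexInt 2)) G₂} : Set (PowerSeries (PadicComplexInt 2))) =
        Ideal.span {G₁}) := by
  intro K _ _ hK _hodd hdisc ι v vbar hv hvbar hne hι Ω δ Ωp hΩ _hδ κ₁ κ₂ γ₁ γ₂ hpair _hκ₂ hκ₁ _hγ₁ _hγ₂ θ hθ2 _hθne θK hH S hvS hvbS hSram hSunr
    G₂ hG₂ S' hvS' hS'ram hS'unr Ω' Ωp' G₁ hΩ' hG₁ hM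
  exact vLineRestriction_of_supply₁₂ hK ι hv hvbar hne hι hΩ hpair hκ₁ hθ2 hH hvS hvbS hSram hSunr hG₂ hvS' hS'ram hS'unr hΩ' hG₁ hM
    (VLineSupply.exists_vLineSupply_of_discr hK hdisc hv hvbar hne ι hι hpair hκ₁ hθ2 hH)

end Summit.BirchSwinnertonDyer.Rank1Residual.P2.VLineRestriction

end
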